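import Summits.CriticalPhenomena.SAWScalingLimit.Theorems.SAWLoopFugacityFlowIsingBoundaryRatioFrameAdj
import HarnessLib

/-!
# The adjacency axiom of the chart frame, with a ceiling uniform in the modulus (line `fk-anchor-transfer`)
(crux `SAWLoopFugacityFlow.IsingBoundaryRatio`, stmt-CriticalPhenomena-10650)

`eventually_chartFrame_adj` (GEO-1) produces, for `ε, η > 0`, a chart ceiling `R` and an eventual
range of mesh sizes. Its proof takes `R` from the boundary value of the chart at `0` ALONE (radius
`ε/2`), the modulus `η` only entering the mesh range. The assembly of the heart needs exactly this
order of quantifiers — the ladder of scales must fit under the ceiling `R`, while the modulus `η` is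
chosen below the smallest scale — so we restate GEO-1 as `∀ ε, ∃ R, ∀ η, ∀ᶠ δ, …` with the same proof.
Folklore bookkeeping; no new definitions.
-/

noncomputable section

open scoped Classical Topology
open Filter Set Metric SimpleGraph
open Literature.Probability.LatticeModels Literature.Probability.RandomPlanarGeometry
open UpperHalfPlane (upperHalfPlaneSet)

namespace Summit.CriticalPhenomena.SAWScalingLimit.Theorems.IsingBoundaryRatio

/-- **GEO-1 with a ceiling uniform in the modulus.** For `ε > 0` there is `R > 0` such that for every
`η > 0` and all small `δ > 0`, every finite volume `(G, Λ)` agreeing locally with `Ω_δ` in `B(a, ε)`,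
every edge `e` of `G.comap Subtype.val` and `u, v ∈ e`: if `u` is a mesh site with mesh point in
`B(a, ε)` and chart radius `< R`, then `v` is a mesh site in the ball and the chart radii of `u`, `v`
differ by `< η`. Same proof as `eventually_chartFrame_adj`: `R` from the boundary value `φ → a` at `0`
(`exists_forall_dist_lt_of_norm_symm_lt` at `ε/2`), then for each `η` the mesh range from the uniform
continuity of the capped chart radius `min ‖φ⁻¹ ·‖ (R + η)`. [folklore] -/
theorem eventually_chartFrame_adj_unif :
    ∀ (D : DobrushinDomain) (φ : ConformalEquiv upperHalfPlaneSet D.carrier), D.IsChordalUniformizing φ →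
    ∀ (ε : ℝ), 0 < ε → ∃ R : ℝ, 0 < R ∧ ∀ (η : ℝ), 0 < η → ∀ᶠ δ in 𝓝[>] (0 : ℝ),
      ∀ (G : SimpleGraph (Site 2)) [G.LocallyFinite] (Λ : Finset (Site 2)),
        LocalAgreement D.carrier (D.pt 0) ε δ G Λ →
        ∀ e ∈ (G.comap (Subtype.val : ↥Λ → Site 2)).edgeFinset, ∀ u ∈ e, ∀ v ∈ e,
          (u.1 ∈ meshDomain D.carrier δ ∧ meshPoint δ u.1 ∈ Metric.ball (D.pt 0) ε) →
          ‖φ.symm (meshPoint δ u.1)‖ < R →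
            (v.1 ∈ meshDomain D.carrier δ ∧ meshPoint δ v.1 ∈ Metric.ball (D.pt 0) ε) ∧
              |‖φ.symm (meshPoint δ v.1)‖ - ‖φ.symm (meshPoint δ u.1)‖| < η := by
  intro D φ hφ ε hε
  obtain ⟨R, hR, hRε⟩ := exists_forall_dist_lt_of_norm_symm_lt hφ (half_pos hε)
  refine ⟨R, hR, fun η hη => ?_⟩
  obtain ⟨η₁, hη₁, hcont⟩ := exists_forall_dist_min_norm_symm_lt hφ (R + η) hη
  filter_upwards [Ioo_mem_nhdsGT (lt_min hη₁ (half_pos hε))] with δ hδ G _ Λ hLA e he u hu v hv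
    hug huR
  by_cases huv : u = v
  · subst huv
    refine ⟨hug, ?_⟩
    rwa [sub_self, abs_zero]
  -- the edge is a step of `Ω_δ`
  have hadj : (G.comap (Subtype.val : ↥Λ → Site 2)).Adj u v := by
    rw [SimpleGraph.mem_edgeFinset, (Sym2.mem_and_mem_iff huv).1 ⟨hu, hv⟩] at he
    exact he
  have hGadj : G.Adj u.1 v.1 := hadj
  have hΩadj : (discreteDomainGraph D.carrier δ).Adj u.1 v.1 := (hLA u.1 u.2 hug.2 v.1).1.1 hGadj
  obtain ⟨hzu, hzv, hd⟩ := meshPoint_mem_of_discreteDomainGraph_adj hΩadj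
  have hvmesh : v.1 ∈ meshDomain D.carrier δ := (discreteDomainGraph_adj_iff.1 hΩadj).2.2
  have hd' : dist (meshPoint δ v.1) (meshPoint δ u.1) < min η₁ (ε / 2) := by
    rw [_root_.dist_comm]
    refine hd.trans_lt ?_
    rw [abs_of_pos hδ.1]
    exact hδ.2
  -- the mesh point of `u` is `ε/2`-close to `a`, hence that of `v` is `ε`-close
  have hu2 : dist (meshPoint δ u.1) (D.pt 0) < ε / 2 := hRε _ hzu huR
  refine ⟨⟨hvmesh, ?_⟩, ?_⟩
  · rw [Metric.mem_ball]
    calc dist (meshPoint δ v.1) (D.pt 0)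
        ≤ dist (meshPoint δ v.1) (meshPoint δ u.1) + dist (meshPoint δ u.1) (D.pt 0) :=
          _root_.dist_triangle _ _ _
      _ < ε / 2 + ε / 2 := add_lt_add (hd'.trans_le (min_le_right _ _)) hu2
      _ = ε := add_halves ε
  -- the capped chart radii differ by `< η`, and both caps are inactive
  · have key := hcont _ hzv _ hzu (hd'.trans_le (min_le_left _ _))
    have huRη : ‖φ.symm (meshPoint δ u.1)‖ ≤ R + η := (huR.trans (lt_add_of_pos_right R hη)).le
    rw [Real.dist_eq, min_eq_left huRη] at key
    have h1 : min ‖φ.symm (meshPoint δ v.1)‖ (R + η) < R + η := by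
      have h2 := (abs_lt.1 key).2
      linarith
    rwa [min_eq_left ((min_lt_iff.1 h1).resolve_right (lt_irrefl _)).le] at key

/-- **Small chart radius means close to the marked point, with the ceiling monotone**: the set of
points of `D` of chart radius `< R` only shrinks with `R`, so the conclusion of
`exists_forall_dist_lt_of_norm_symm_lt` persists for every smaller positive ceiling. [folklore] -/
theorem forall_dist_lt_of_norm_symm_lt_of_le {D : DobrushinDomain}
    {φ : ConformalEquiv upperHalfPlaneSet D.carrier} {ε R R' : ℝ}
    (h : ∀ z ∈ D.carrier, ‖φ.symm z‖ < R → dist z (D.pt 0) < ε) (hR' : R' ≤ R) :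
    ∀ z ∈ D.carrier, ‖φ.symm z‖ < R' → dist z (D.pt 0) < ε :=
  fun z hz hzR' => h z hz (hzR'.trans_le hR')

end Summit.CriticalPhenomena.SAWScalingLimit.Theorems.IsingBoundaryRatio

end
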